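import Literature.NumberTheory.K2Lit.AdelicPlaceSplitting
import Literature.NumberTheory.Automorphic.UnitaryGroupAdelicProductHaar
import Literature.NumberTheory.Automorphic.UnitaryGroupArchTopology
import Summits.HodgeConjecture.HodgeConjecture.Theorems.K2LiuAdelicPlaceSplittingFubini
import Mathlib.MeasureTheory.Integral.Prod

/-!
# The `S`-splitting of a Haar measure on `U(J)(𝔸_F)` and the Fubini behind `Z(s) = (∏_{v∉S} c_v(s))·Z_S(s)`

Track B ∕ K2-LIT, hLiu418 = stmt-HodgeConjecture-24832, LOCAL SEAM of s23 (DEPMAP v2.1 `Cruxes/HLiu418/Lines/K2_Liu_LocalSeam_s23.md` §1 (c),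
§2 (LS0), file #29 `DoublingPartialEuler`). Helper file (count-neutral): the measure-theoretic backbone that the partial Euler product of the
doubling zeta integral needs, over ★ `UnitaryGroup.adelicProdEquiv` (`U(J)(𝔸_F) ≃ₜ* U(J)(E ⊗ ℝ) × U(J)(𝔸_{F,f})`) and ★ `PlaceSplitting.splitPlaces`
(D7′, `U(J)(𝔸_{F,f}) ≃ₜ* Π_{v∈S} U(J)(F_v) × Πʳ_{v∉S} [U(J)(F_v), U(J)(𝒪_v)]`). Stated for general `E ∕ F`, `c`, `J` (the CM datum of the line,
`F = L⁺`, `E = L`, `c` = complex conjugation, `J = H`, is an instance; ★ `placesEmbed L H S (a, x)` of D7b `K2Lit/LocalDoublingZeta` is by definition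
`archToAdelic a · finAdelicToAdelic (splitPlaces⁻¹ (x, 1))`, the `y = 1` slice of the gluing below).

* `exists_isHaarMeasure_map_archSplit_eq_prod` — **a Haar measure `ν` on `U(J)(𝔸_F)` splits as `ν_∞ ⊗ (ν_S ⊗ ν^S)`**: σ-finite Haar measures `ν_∞` on
  `U(J)(E ⊗ ℝ)`, `ν_S` on `Π_{v∈S} U(J)(F_v)`, `ν^S` on `Πʳ_{v∉S}` with `(g ↦ (g_∞, (g_v)_{v∈S}, (g_v)_{v∉S}))_* ν = ν_∞ ⊗ (ν_S ⊗ ν^S)`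
  (★ `Literature.MeasureTheory.Group.exists_map_continuousMulEquiv_eq_smul_prod`, scalar absorbed into `ν_∞`; instances ★ `K2LiuAdelicPlaceSplittingFubini` §0,
  ★ `UnitaryGroupArchTopology`).
* `glue_eq_mul` — the inverse gluing `(a, x, y) ↦ (a, 1)·(1, ι_S x)·(1, ι^S y)`.
* `integral_eq_integral_archSplit` — `∫_{U(J)(𝔸)} F dν = ∫ F((a,1)·(1, ι_S x)·(1, ι^S y)) d(ν_∞ ⊗ (ν_S ⊗ ν^S))` (every `F`);
  `integral_eq_integral_integral_off` — **Fubini**: for `ν`-integrable `F`,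
  `∫_{U(J)(𝔸)} F dν = ∫_{G_∞ × G_S} ∫_{G^S} F((a,1)·(1, ι_S x)·(1, ι^S y)) dν^S(y) d(ν_∞ ⊗ ν_S)(a, x)`.

Everything proved (Mathlib + tree), no `def`, no `sorry`; axioms ⊆ {propext, Classical.choice, Quot.sound}.
HONEST LABEL: HC_CM is proved only modulo the printed citations (2 remaining named inputs: hLiu418 = stmt-HodgeConjecture-24832, h413 =
stmt-HodgeConjecture-24833) until rung 0 closes; this file is unconditional and moves no counter.
References: A. Borel, H. Jacquet, Proc. Sympos. Pure Math. 33.1 (1979) §4.1 [BorelJacquet1979]; J. Tate in Cassels–Fröhlich (1967) Ch. XV §3.3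
[CasselsFrohlichANT1967]; Y. Liu, ANT 5 (2011) §2B Prop. 2.3 p. 862 [Liu2011]; D. Bump, *Automorphic Forms and Representations* (1997) §3.3 [Bump1997].
-/

set_option autoImplicit false

set_option linter.dupNamespace false

noncomputable section

open scoped RestrictedProduct ENNReal NNReal
open MeasureTheory MeasureTheory.Measure NumberField IsDedekindDomain

namespace Summit.HodgeConjecture.HodgeConjecture.Cruxes.HLiu418.K2LiuDoublingZetaPlaceSplitting

open Literature.NumberTheory.Automorphic
open Literature.NumberTheory.K2Lit.PlaceSplitting
open Summit.HodgeConjecture.HodgeConjecture.Cruxes.HLiu418.K2LiuAdelicPlaceSplittingFubini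

variable (F E : Type) [Field F] [NumberField F] [Field E] [NumberField E] [Algebra F E]
  (c : E ≃ₐ[F] E) (N : ℕ) (J : Matrix (Fin N) (Fin N) E)
  (S : Finset (HeightOneSpectrum (𝓞 F))) [DecidableEq (HeightOneSpectrum (𝓞 F))]
  [MeasurableSpace (UnitaryGroup.adelicGroupData F E c N J).Adelic] [BorelSpace (UnitaryGroup.adelicGroupData F E c N J).Adelic]
  [MeasurableSpace (UnitaryGroup.arch F E c N J)] [BorelSpace (UnitaryGroup.arch F E c N J)]
  [∀ v : HeightOneSpectrum (𝓞 F), MeasurableSpace (UnitaryGroup.localPi E c N J v)]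
  [∀ v : HeightOneSpectrum (𝓞 F), BorelSpace (UnitaryGroup.localPi E c N J v)]

omit [MeasurableSpace (UnitaryGroup.adelicGroupData F E c N J).Adelic] [BorelSpace (UnitaryGroup.adelicGroupData F E c N J).Adelic]
  [MeasurableSpace (UnitaryGroup.arch F E c N J)] [BorelSpace (UnitaryGroup.arch F E c N J)]
  [∀ v : HeightOneSpectrum (𝓞 F), MeasurableSpace (UnitaryGroup.localPi E c N J v)]
  [∀ v : HeightOneSpectrum (𝓞 F), BorelSpace (UnitaryGroup.localPi E c N J v)] in
/-- **the gluing `(a, x, y) ↦ (a, 1)·(1, ι_S x · ι^S y)` factors as `(a,1)·(1, ι_S x)·(1, ι^S y)`** (★ `adelicProdEquiv_symm_apply`; the first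
two factors are ★ `placesEmbed` at the CM datum). [cite: BorelJacquet1979, §4.1] [cite: Liu2011, §2B p. 862] -/
theorem glue_eq_mul (a : UnitaryGroup.arch F E c N J) (x : Π v : S, UnitaryGroup.localPi E c N J v.1)
    (y : Πʳ v : {v // v ∉ S}, [UnitaryGroup.localPi E c N J v.1, UnitaryGroup.localInt E c N J v.1]) :
    (UnitaryGroup.adelicProdEquiv F E c N J).symm (a, (splitPlaces F E c N J S).symm (x, y)) =
      UnitaryGroup.archToAdelic F E c N J a *
        UnitaryGroup.finAdelicToAdelic F E c N J ((splitPlaces F E c N J S).symm (x, 1)) *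
          UnitaryGroup.finAdelicToAdelic F E c N J ((splitPlaces F E c N J S).symm (1, y)) := by
  have hxy' : ((x, y) : (Π v : S, UnitaryGroup.localPi E c N J v.1) ×
      (Πʳ v : {v // v ∉ S}, [UnitaryGroup.localPi E c N J v.1, UnitaryGroup.localInt E c N J v.1])) = (x, 1) * (1, y) := by
    rw [Prod.mk_mul_mk, mul_one, one_mul]
  have hxy : (splitPlaces F E c N J S).symm (x, y) =
      (splitPlaces F E c N J S).symm (x, 1) * (splitPlaces F E c N J S).symm (1, y) := by
    rw [hxy', map_mul]
  rw [UnitaryGroup.adelicProdEquiv_symm_apply, hxy, (UnitaryGroup.finAdelicToAdelic F E c N J).map_mul, mul_assoc]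

/-- **a Haar measure on `U(J)(𝔸_F)` splits as `ν_∞ ⊗ (ν_S ⊗ ν^S)`** along `g ↦ (g_∞, (g_v)_{v∈S}, (g_v)_{v∉S})`, with σ-finite Haar factors
(the scalar of Haar uniqueness absorbed into `ν_∞`). [cite: BorelJacquet1979, §4.1] [cite: CasselsFrohlichANT1967, Ch. XV (Tate) §3.3] [cite: Bump1997, §3.3 Prop. 3.3.2] -/
theorem exists_isHaarMeasure_map_archSplit_eq_prod
    (ν : Measure (UnitaryGroup.adelicGroupData F E c N J).Adelic) [ν.IsHaarMeasure] :
    ∃ (νinf : Measure (UnitaryGroup.arch F E c N J))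
      (νS : Measure (Π v : S, UnitaryGroup.localPi E c N J v.1))
      (νoff : Measure (Πʳ v : {v // v ∉ S}, [UnitaryGroup.localPi E c N J v.1, UnitaryGroup.localInt E c N J v.1])),
      νinf.IsHaarMeasure ∧ νS.IsHaarMeasure ∧ νoff.IsHaarMeasure ∧ SigmaFinite νinf ∧ SigmaFinite νS ∧ SigmaFinite νoff ∧
        Measure.map (fun g => (UnitaryGroup.archPart F E c N J g, splitPlaces F E c N J S (UnitaryGroup.finPart F E c N J g))) ν =
          νinf.prod (νS.prod νoff) := by
  haveI : Countable (HeightOneSpectrum (𝓞 F)) := countable_heightOneSpectrum F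
  haveI : ∀ v, SecondCountableTopology (UnitaryGroup.localPi E c N J v) :=
    fun v => UnitaryGroup.secondCountableTopology_localPi E N c J v
  haveI : ∀ v, LocallyCompactSpace (UnitaryGroup.localPi E c N J v) :=
    fun v => UnitaryGroup.locallyCompactSpace_localPi E N c J v
  have hBc : ∀ v, IsCompact (UnitaryGroup.localInt E c N J v : Set (UnitaryGroup.localPi E c N J v)) :=
    fun v => UnitaryGroup.isCompact_localInt E c N J v
  haveI := fact_isOpen_off (fun v => UnitaryGroup.localPi E c N J v) (fun v => UnitaryGroup.localInt E c N J v) S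
  haveI := borelSpace_off (fun v => UnitaryGroup.localPi E c N J v) (fun v => UnitaryGroup.localInt E c N J v) S
  haveI := secondCountableTopology_off (fun v => UnitaryGroup.localPi E c N J v) (fun v => UnitaryGroup.localInt E c N J v) S
  haveI := locallyCompactSpace_off (fun v => UnitaryGroup.localPi E c N J v) (fun v => UnitaryGroup.localInt E c N J v) S hBc
  -- the splitting isomorphism `g ↦ (g_∞, (g_S, g^S))`
  let E₃ : (UnitaryGroup.adelicGroupData F E c N J).Adelic ≃ₜ*
      UnitaryGroup.arch F E c N J ×
        ((Π v : S, UnitaryGroup.localPi E c N J v.1) ×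
          (Πʳ v : {v // v ∉ S}, [UnitaryGroup.localPi E c N J v.1, UnitaryGroup.localInt E c N J v.1])) :=
    { ((UnitaryGroup.adelicProdEquiv F E c N J).toMulEquiv.trans
        (MulEquiv.prodCongr (MulEquiv.refl _) (splitPlaces F E c N J S).toMulEquiv)) with
      continuous_toFun :=
        (UnitaryGroup.continuous_archPart F E c N J).prodMk
          ((splitPlaces F E c N J S).continuous.comp (UnitaryGroup.continuous_finPart F E c N J))
      continuous_invFun :=
        (UnitaryGroup.adelicProdEquiv F E c N J).symm.continuous.comp
          (continuous_fst.prodMk ((splitPlaces F E c N J S).symm.continuous.comp continuous_snd)) }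
  obtain ⟨κ, hκ, hmap⟩ := Literature.MeasureTheory.Group.exists_map_continuousMulEquiv_eq_smul_prod E₃ ν
    (Measure.haar : Measure (UnitaryGroup.arch F E c N J))
    ((Measure.haar : Measure (Π v : S, UnitaryGroup.localPi E c N J v.1)).prod
      (Measure.haar : Measure (Πʳ v : {v // v ∉ S}, [UnitaryGroup.localPi E c N J v.1, UnitaryGroup.localInt E c N J v.1])))
  refine ⟨κ • Measure.haar, Measure.haar, Measure.haar, IsHaarMeasure.nnreal_smul _ hκ.ne', inferInstance, inferInstance,
    inferInstance, inferInstance, inferInstance, ?_⟩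
  rw [Measure.prod_smul_left, ← hmap]
  rfl

/-- **transport of the integral** (every `F₀`, no integrability needed): `∫_{U(J)(𝔸)} F₀ dν = ∫ F₀((a,1)·(1, ι_S x)·(1, ι^S y)) d(ν_∞ ⊗ (ν_S ⊗ ν^S))`
for measures as in `exists_isHaarMeasure_map_archSplit_eq_prod`. [cite: BorelJacquet1979, §4.1] [cite: Bump1997, §3.3 Prop. 3.3.2] -/
theorem integral_eq_integral_archSplit {𝕜 : Type} [NormedAddCommGroup 𝕜] [NormedSpace ℝ 𝕜]
    (ν : Measure (UnitaryGroup.adelicGroupData F E c N J).Adelic)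
    {νinf : Measure (UnitaryGroup.arch F E c N J)} {νS : Measure (Π v : S, UnitaryGroup.localPi E c N J v.1)}
    {νoff : Measure (Πʳ v : {v // v ∉ S}, [UnitaryGroup.localPi E c N J v.1, UnitaryGroup.localInt E c N J v.1])}
    (hmap : Measure.map (fun g => (UnitaryGroup.archPart F E c N J g, splitPlaces F E c N J S (UnitaryGroup.finPart F E c N J g))) ν =
      νinf.prod (νS.prod νoff))
    (F₀ : (UnitaryGroup.adelicGroupData F E c N J).Adelic → 𝕜) :
    ∫ g, F₀ g ∂ν =
      ∫ z, F₀ (UnitaryGroup.archToAdelic F E c N J z.1 *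
          UnitaryGroup.finAdelicToAdelic F E c N J ((splitPlaces F E c N J S).symm (z.2.1, 1)) *
            UnitaryGroup.finAdelicToAdelic F E c N J ((splitPlaces F E c N J S).symm (1, z.2.2))) ∂(νinf.prod (νS.prod νoff)) := by
  haveI : Countable (HeightOneSpectrum (𝓞 F)) := countable_heightOneSpectrum F
  haveI : ∀ v, SecondCountableTopology (UnitaryGroup.localPi E c N J v) :=
    fun v => UnitaryGroup.secondCountableTopology_localPi E N c J v
  haveI := fact_isOpen_off (fun v => UnitaryGroup.localPi E c N J v) (fun v => UnitaryGroup.localInt E c N J v) S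
  haveI := borelSpace_off (fun v => UnitaryGroup.localPi E c N J v) (fun v => UnitaryGroup.localInt E c N J v) S
  haveI hS2 : SecondCountableTopology (Π v : S, UnitaryGroup.localPi E c N J v.1) := inferInstance
  haveI : SecondCountableTopologyEither (Π v : S, UnitaryGroup.localPi E c N J v.1)
      (Πʳ v : {v // v ∉ S}, [UnitaryGroup.localPi E c N J v.1, UnitaryGroup.localInt E c N J v.1]) :=
    secondCountableTopologyEither_of_left _ _
  haveI : BorelSpace ((Π v : S, UnitaryGroup.localPi E c N J v.1) ×
      (Πʳ v : {v // v ∉ S}, [UnitaryGroup.localPi E c N J v.1, UnitaryGroup.localInt E c N J v.1])) := Prod.borelSpace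
  haveI : SecondCountableTopologyEither (UnitaryGroup.arch F E c N J) ((Π v : S, UnitaryGroup.localPi E c N J v.1) ×
      (Πʳ v : {v // v ∉ S}, [UnitaryGroup.localPi E c N J v.1, UnitaryGroup.localInt E c N J v.1])) :=
    secondCountableTopologyEither_of_left _ _
  haveI : BorelSpace (UnitaryGroup.arch F E c N J × ((Π v : S, UnitaryGroup.localPi E c N J v.1) ×
      (Πʳ v : {v // v ∉ S}, [UnitaryGroup.localPi E c N J v.1, UnitaryGroup.localInt E c N J v.1]))) := Prod.borelSpace
  let E₃ : (UnitaryGroup.adelicGroupData F E c N J).Adelic ≃ₜ*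
      UnitaryGroup.arch F E c N J ×
        ((Π v : S, UnitaryGroup.localPi E c N J v.1) ×
          (Πʳ v : {v // v ∉ S}, [UnitaryGroup.localPi E c N J v.1, UnitaryGroup.localInt E c N J v.1])) :=
    { ((UnitaryGroup.adelicProdEquiv F E c N J).toMulEquiv.trans
        (MulEquiv.prodCongr (MulEquiv.refl _) (splitPlaces F E c N J S).toMulEquiv)) with
      continuous_toFun :=
        (UnitaryGroup.continuous_archPart F E c N J).prodMk
          ((splitPlaces F E c N J S).continuous.comp (UnitaryGroup.continuous_finPart F E c N J))
      continuous_invFun :=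
        (UnitaryGroup.adelicProdEquiv F E c N J).symm.continuous.comp
          (continuous_fst.prodMk ((splitPlaces F E c N J S).symm.continuous.comp continuous_snd)) }
  have hE : Measure.map E₃ ν = νinf.prod (νS.prod νoff) := hmap
  have hcoe : (E₃.toHomeomorph.toMeasurableEquiv : _ → _) = E₃ := Homeomorph.toMeasurableEquiv_coe _
  have h1 : ∫ z, F₀ (E₃.symm z) ∂(Measure.map E₃ ν) = ∫ g, F₀ g ∂ν := by
    rw [← hcoe, integral_map_equiv]
    exact integral_congr_ae (Filter.Eventually.of_forall fun g => by simp only [hcoe, ContinuousMulEquiv.symm_apply_apply])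
  rw [← h1, hE]
  refine integral_congr_ae (Filter.Eventually.of_forall fun z => ?_)
  show F₀ ((UnitaryGroup.adelicProdEquiv F E c N J).symm (z.1, (splitPlaces F E c N J S).symm (z.2.1, z.2.2))) = _
  rw [glue_eq_mul]

/-- **Fubini over the `S`-splitting**: for `ν`-integrable `F₀`,
`∫_{U(J)(𝔸)} F₀ dν = ∫_{G_∞ × G_S} ∫_{G^S} F₀((a,1)·(1, ι_S x)·(1, ι^S y)) dν^S(y) d(ν_∞ ⊗ ν_S)(a, x)` — at the CM datum the outer
argument `(a,1)·(1, ι_S x)` is ★ `placesEmbed S (a, x)` (D7b), and the inner integral is what the doubling Hecke operators off `S` compute (file #29).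
[cite: Liu2011, §2B Prop. 2.3 p. 862] [cite: BorelJacquet1979, §4.1] -/
theorem integral_eq_integral_integral_off {𝕜 : Type} [NormedAddCommGroup 𝕜] [NormedSpace ℝ 𝕜]
    (ν : Measure (UnitaryGroup.adelicGroupData F E c N J).Adelic)
    {νinf : Measure (UnitaryGroup.arch F E c N J)} {νS : Measure (Π v : S, UnitaryGroup.localPi E c N J v.1)}
    {νoff : Measure (Πʳ v : {v // v ∉ S}, [UnitaryGroup.localPi E c N J v.1, UnitaryGroup.localInt E c N J v.1])}
    [SigmaFinite νinf] [SigmaFinite νS] [SigmaFinite νoff]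
    (hmap : Measure.map (fun g => (UnitaryGroup.archPart F E c N J g, splitPlaces F E c N J S (UnitaryGroup.finPart F E c N J g))) ν =
      νinf.prod (νS.prod νoff))
    (F₀ : (UnitaryGroup.adelicGroupData F E c N J).Adelic → 𝕜) (hF : Integrable F₀ ν) :
    ∫ g, F₀ g ∂ν =
      ∫ p, ∫ y, F₀ (UnitaryGroup.archToAdelic F E c N J p.1 *
          UnitaryGroup.finAdelicToAdelic F E c N J ((splitPlaces F E c N J S).symm (p.2, 1)) *
            UnitaryGroup.finAdelicToAdelic F E c N J ((splitPlaces F E c N J S).symm (1, y))) ∂νoff ∂(νinf.prod νS) := by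
  haveI : Countable (HeightOneSpectrum (𝓞 F)) := countable_heightOneSpectrum F
  haveI : ∀ v, SecondCountableTopology (UnitaryGroup.localPi E c N J v) :=
    fun v => UnitaryGroup.secondCountableTopology_localPi E N c J v
  haveI := fact_isOpen_off (fun v => UnitaryGroup.localPi E c N J v) (fun v => UnitaryGroup.localInt E c N J v) S
  haveI := borelSpace_off (fun v => UnitaryGroup.localPi E c N J v) (fun v => UnitaryGroup.localInt E c N J v) S
  haveI hS2 : SecondCountableTopology (Π v : S, UnitaryGroup.localPi E c N J v.1) := inferInstance
  haveI : SecondCountableTopologyEither (Π v : S, UnitaryGroup.localPi E c N J v.1)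
      (Πʳ v : {v // v ∉ S}, [UnitaryGroup.localPi E c N J v.1, UnitaryGroup.localInt E c N J v.1]) :=
    secondCountableTopologyEither_of_left _ _
  haveI : BorelSpace ((Π v : S, UnitaryGroup.localPi E c N J v.1) ×
      (Πʳ v : {v // v ∉ S}, [UnitaryGroup.localPi E c N J v.1, UnitaryGroup.localInt E c N J v.1])) := Prod.borelSpace
  haveI : SecondCountableTopologyEither (UnitaryGroup.arch F E c N J) ((Π v : S, UnitaryGroup.localPi E c N J v.1) ×
      (Πʳ v : {v // v ∉ S}, [UnitaryGroup.localPi E c N J v.1, UnitaryGroup.localInt E c N J v.1])) :=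
    secondCountableTopologyEither_of_left _ _
  haveI : BorelSpace (UnitaryGroup.arch F E c N J × ((Π v : S, UnitaryGroup.localPi E c N J v.1) ×
      (Πʳ v : {v // v ∉ S}, [UnitaryGroup.localPi E c N J v.1, UnitaryGroup.localInt E c N J v.1]))) := Prod.borelSpace
  let E₃ : (UnitaryGroup.adelicGroupData F E c N J).Adelic ≃ₜ*
      UnitaryGroup.arch F E c N J ×
        ((Π v : S, UnitaryGroup.localPi E c N J v.1) ×
          (Πʳ v : {v // v ∉ S}, [UnitaryGroup.localPi E c N J v.1, UnitaryGroup.localInt E c N J v.1])) :=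
    { ((UnitaryGroup.adelicProdEquiv F E c N J).toMulEquiv.trans
        (MulEquiv.prodCongr (MulEquiv.refl _) (splitPlaces F E c N J S).toMulEquiv)) with
      continuous_toFun :=
        (UnitaryGroup.continuous_archPart F E c N J).prodMk
          ((splitPlaces F E c N J S).continuous.comp (UnitaryGroup.continuous_finPart F E c N J))
      continuous_invFun :=
        (UnitaryGroup.adelicProdEquiv F E c N J).symm.continuous.comp
          (continuous_fst.prodMk ((splitPlaces F E c N J S).symm.continuous.comp continuous_snd)) }
  have hE : Measure.map E₃ ν = νinf.prod (νS.prod νoff) := hmap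
  have hmpE : MeasurePreserving E₃ ν (νinf.prod (νS.prod νoff)) := ⟨E₃.continuous.measurable, hE⟩
  have hsymm : MeasurePreserving E₃.symm (νinf.prod (νS.prod νoff)) ν := hmpE.symm E₃.toHomeomorph.toMeasurableEquiv
  have hint : Integrable (fun z => F₀ (E₃.symm z)) (νinf.prod (νS.prod νoff)) :=
    (hsymm.integrable_comp_emb E₃.symm.toHomeomorph.toMeasurableEquiv.measurableEmbedding).2 hF
  have hG : (fun z : UnitaryGroup.arch F E c N J ×
      ((Π v : S, UnitaryGroup.localPi E c N J v.1) ×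
        (Πʳ v : {v // v ∉ S}, [UnitaryGroup.localPi E c N J v.1, UnitaryGroup.localInt E c N J v.1])) =>
      F₀ (UnitaryGroup.archToAdelic F E c N J z.1 *
        UnitaryGroup.finAdelicToAdelic F E c N J ((splitPlaces F E c N J S).symm (z.2.1, 1)) *
          UnitaryGroup.finAdelicToAdelic F E c N J ((splitPlaces F E c N J S).symm (1, z.2.2)))) = fun z => F₀ (E₃.symm z) := by
    funext z
    show _ = F₀ ((UnitaryGroup.adelicProdEquiv F E c N J).symm (z.1, (splitPlaces F E c N J S).symm (z.2.1, z.2.2)))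
    rw [glue_eq_mul]
  rw [integral_eq_integral_archSplit F E c N J S ν hmap F₀, hG]
  have hassoc := MeasureTheory.measurePreserving_prodAssoc νinf νS νoff
  have hint' : Integrable (fun w : (UnitaryGroup.arch F E c N J × (Π v : S, UnitaryGroup.localPi E c N J v.1)) ×
      (Πʳ v : {v // v ∉ S}, [UnitaryGroup.localPi E c N J v.1, UnitaryGroup.localInt E c N J v.1]) =>
        F₀ (E₃.symm (MeasurableEquiv.prodAssoc w))) ((νinf.prod νS).prod νoff) :=
    (hassoc.integrable_comp_emb MeasurableEquiv.prodAssoc.measurableEmbedding).2 hint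
  rw [← hassoc.integral_comp' (fun z => F₀ (E₃.symm z)), integral_prod _ hint']
  refine integral_congr_ae (Filter.Eventually.of_forall fun p => integral_congr_ae (Filter.Eventually.of_forall fun y => ?_))
  show F₀ ((UnitaryGroup.adelicProdEquiv F E c N J).symm (p.1, (splitPlaces F E c N J S).symm (p.2, y))) = _
  rw [glue_eq_mul]

end Summit.HodgeConjecture.HodgeConjecture.Cruxes.HLiu418.K2LiuDoublingZetaPlaceSplitting

end
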